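import Summits.RiemannHypothesis.RiemannHypothesis.Theorems.PfPersistenceInWindowMirror
import Summits.RiemannHypothesis.RiemannHypothesis.Theorems.PfPersistenceBoundedIndexReaders
import HarnessLib

/-!
# PF persistence — bottom vectors EXIST; the variational gap binder and a variational DAVIS–KAHAN lemma
(pub-rhpf, barrier-prover gen 3; file 1 of 3 of the rank-one-dominance / eigenvector-tolerance packet)

**HONEST FRAMING. This is a long-odds MECHANISM SEARCH; no RH claims.** Everything in this file is RH-free,
finite-dimensional linear algebra about real window matrices (`Matrix (Fin n) (Fin n) ℝ`), their bottom Rayleigh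
value `bottomRayleigh` (`ε₁`) and bottom vectors `IsBottomVector` — the `eigvec` tier of the cell's admissible
class `𝒞`. Nothing here bears on the truth of RH. Labels: every statement below is PROVED; no DATA.

* §1–§2 EXISTENCE AND VARIATIONAL CHARACTERISATION OF BOTTOM VECTORS. For a real SYMMETRIC matrix in positive
  dimension a bottom vector exists (`exists_isBottomVector_of_isSymm`: minimise the quadratic form on the compact
  Euclidean unit sphere; the first-order condition comes from `ε₁ |v|² ≤ vᵀMv` along the line `u + t r`, `r` the
  residual, via the discriminant), and every Rayleigh minimiser is a bottom vector (`isBottomVector_of_form_eq`).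
  Until now the tree only USED `IsBottomVector` as a hypothesis (readers `oneSignedAt`, `floorNodelessAt`, …).
* §3 THE VARIATIONAL GAP BINDER `HasBottomGap M u₀ γ` (bottom vector `u₀`; `(ε₁ + γ)|v|² ≤ vᵀMv` on `v ⊥ u₀`) —
  the per-window NUMERICAL fact (certifiable by interval arithmetic on ONE matrix) under which eigenvector readers
  are continuous; the sign-blind, scale-free direction tolerance `SinSqLe τ u u₀` (`(1 − τ)|u|²|u₀|² ≤ (u·u₀)²`,
  i.e. `sin² ∠(u, ±u₀) ≤ τ`); the division-free orthogonal decomposition `|u₀|² u = orthPart u u₀ + (u·u₀) u₀`;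
  and simplicity of a gapped bottom (`sinSqLe_zero_of_hasBottomGap`).
* §4 **VARIATIONAL DAVIS–KAHAN** (`sinSqLe_of_isBottomVector`): `M₀` symmetric with `HasBottomGap M₀ u₀ γ`, `M`
  form-close (`|vᵀ(M₀ − M)v| ≤ ε|v|²`, one window of the cell's `UniformlyClose ε`) ⇒ EVERY bottom vector `u` of
  `M` (no symmetry of `M` needed) satisfies `SinSqLe (2ε/γ) u u₀`. This is the kernel form of the cell's DERIVED
  "Davis–Kahan closure" certificates (C5-N5 / RULING A54). Companion files: `PfPersistenceConeSigns` (cones ⇒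
  one-signed coordinates / profiles), `PfPersistenceRankOneDominance` (Perron–Frobenius by dominance).
-/

set_option linter.dupNamespace false  -- the mandated namespace repeats `RiemannHypothesis`

noncomputable section

open Real Finset Matrix Set

namespace Summit.RiemannHypothesis.RiemannHypothesis.Theorems.PfPersistence

/-! ## §1 Symmetric forms: polarisation helpers -/

/-- PROVED: expansion of the quadratic form along a line, `(x + t r)ᵀM(x + t r) = xᵀMx + 2t rᵀMx + t² rᵀMr`
(symmetric `M`). [folklore] -/
theorem form_add_smul_of_isSymm {n : ℕ} {M : Matrix (Fin n) (Fin n) ℝ} (hM : M.IsSymm) (x r : Fin n → ℝ)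
    (t : ℝ) :
    (x + t • r) ⬝ᵥ (M *ᵥ (x + t • r)) =
      x ⬝ᵥ (M *ᵥ x) + 2 * t * (r ⬝ᵥ (M *ᵥ x)) + t * t * (r ⬝ᵥ (M *ᵥ r)) := by
  have h1 : x ⬝ᵥ (M *ᵥ r) = r ⬝ᵥ (M *ᵥ x) := by
    rw [dotProduct_mulVec, ← mulVec_transpose, hM.eq, dotProduct_comm]
  simp only [mulVec_add, mulVec_smul, dotProduct_add, add_dotProduct, dotProduct_smul, smul_dotProduct,
    smul_eq_mul, h1]
  ring

/-- PROVED: expansion of the squared length along a line. [folklore] -/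
theorem dotProduct_add_smul_self {n : ℕ} (x r : Fin n → ℝ) (t : ℝ) :
    (x + t • r) ⬝ᵥ (x + t • r) = x ⬝ᵥ x + 2 * t * (r ⬝ᵥ x) + t * t * (r ⬝ᵥ r) := by
  simp only [dotProduct_add, add_dotProduct, dotProduct_smul, smul_dotProduct, smul_eq_mul, dotProduct_comm x r]
  ring

/-- PROVED: a squared coordinate is at most the squared length. [folklore] -/
theorem coord_sq_le_dotSelf {n : ℕ} (v : Fin n → ℝ) (i : Fin n) : v i ^ 2 ≤ v ⬝ᵥ v := by
  rw [sq]
  exact Finset.single_le_sum (f := fun k => v k * v k) (fun k _ => mul_self_nonneg (v k)) (Finset.mem_univ i)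

/-! ## §2 Bottom vectors: the variational characterisation and EXISTENCE for symmetric matrices -/

/-- PROVED: the quadratic form at a bottom vector is `ε₁ |u|²` (no symmetry needed). [folklore] -/
theorem form_eq_of_isBottomVector {n : ℕ} {M : Matrix (Fin n) (Fin n) ℝ} {u : Fin n → ℝ}
    (h : IsBottomVector M u) : u ⬝ᵥ (M *ᵥ u) = bottomRayleigh M * (u ⬝ᵥ u) := by
  rw [h.2, dotProduct_smul, smul_eq_mul]

/-- PROVED: `wᵀ M u = ε₁ (w·u)` at a bottom vector `u` (no symmetry needed). [folklore] -/
theorem dotProduct_mulVec_of_isBottomVector {n : ℕ} {M : Matrix (Fin n) (Fin n) ℝ} {u : Fin n → ℝ}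
    (h : IsBottomVector M u) (w : Fin n → ℝ) : w ⬝ᵥ (M *ᵥ u) = bottomRayleigh M * (w ⬝ᵥ u) := by
  rw [h.2, dotProduct_smul, smul_eq_mul]

/-- **PROVED — RAYLEIGH MINIMISERS ARE BOTTOM VECTORS (symmetric case).** If `M` is symmetric, `u ≠ 0` and
`uᵀMu = ε₁ |u|²`, then `Mu = ε₁ u`. Proof: along the line `u + t r` with `r := Mu − ε₁u` the inequality
`ε₁|v|² ≤ vᵀMv` reads `0 ≤ a t² + 2|r|² t`, whose discriminant forces `|r|² = 0`. [folklore] -/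
theorem isBottomVector_of_form_eq {n : ℕ} {M : Matrix (Fin n) (Fin n) ℝ} (hM : M.IsSymm) {u : Fin n → ℝ}
    (hu : u ≠ 0) (hmin : u ⬝ᵥ (M *ᵥ u) = bottomRayleigh M * (u ⬝ᵥ u)) : IsBottomVector M u := by
  refine ⟨hu, ?_⟩
  set r : Fin n → ℝ := M *ᵥ u - bottomRayleigh M • u with hr
  have hb : r ⬝ᵥ (M *ᵥ u) - bottomRayleigh M * (r ⬝ᵥ u) = r ⬝ᵥ r := by
    have e : r ⬝ᵥ r = r ⬝ᵥ (M *ᵥ u - bottomRayleigh M • u) := rfl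
    rw [e, dotProduct_sub, dotProduct_smul, smul_eq_mul]
  have key : ∀ t : ℝ,
      0 ≤ (r ⬝ᵥ (M *ᵥ r) - bottomRayleigh M * (r ⬝ᵥ r)) * (t * t) + 2 * (r ⬝ᵥ r) * t + 0 := by
    intro t
    have h := bottomRayleigh_mul_le_form M (u + t • r)
    rw [form_add_smul_of_isSymm hM, dotProduct_add_smul_self] at h
    have hb' : t * (r ⬝ᵥ (M *ᵥ u)) - t * (bottomRayleigh M * (r ⬝ᵥ u)) = t * (r ⬝ᵥ r) := by
      rw [← mul_sub, hb]
    nlinarith [h, hb', hmin]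
  have hd := discrim_le_zero key
  rw [discrim] at hd
  have hsq : (r ⬝ᵥ r) ^ 2 = 0 := le_antisymm (by nlinarith [hd]) (sq_nonneg _)
  have h0 : r ⬝ᵥ r = 0 := (pow_eq_zero_iff two_ne_zero).1 hsq
  have hr0 : r = 0 := dotProduct_self_eq_zero.1 h0
  exact sub_eq_zero.1 hr0

/-- PROVED: the Euclidean unit sphere `{v | v·v = 1}` of `Fin n → ℝ` is compact (closed, inside the sup-norm
unit ball). [folklore] -/
theorem isCompact_dotSelf_eq_one (n : ℕ) : IsCompact {v : Fin n → ℝ | v ⬝ᵥ v = 1} := by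
  have hc : Continuous fun v : Fin n → ℝ => v ⬝ᵥ v := continuous_id.dotProduct continuous_id
  refine (isCompact_closedBall (0 : Fin n → ℝ) 1).of_isClosed_subset (isClosed_eq hc continuous_const) ?_
  intro v hv
  simp only [mem_setOf_eq] at hv
  rw [Metric.mem_closedBall, dist_zero_right, pi_norm_le_iff_of_nonneg zero_le_one]
  intro i
  rw [Real.norm_eq_abs, abs_le_one_iff_mul_self_le_one, ← sq, ← hv]
  exact coord_sq_le_dotSelf v i

/-- **PROVED — BOTTOM VECTORS EXIST (symmetric matrices, positive dimension).** A real symmetric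
`(n+1) × (n+1)` matrix has a bottom vector, indeed a Euclidean-unit one: the quadratic form attains its minimum on
the compact unit sphere, the minimum value is `ε₁`, and minimisers are bottom vectors. [folklore] -/
theorem exists_isBottomVector_of_isSymm {n : ℕ} {M : Matrix (Fin (n + 1)) (Fin (n + 1)) ℝ} (hM : M.IsSymm) :
    ∃ u : Fin (n + 1) → ℝ, IsBottomVector M u ∧ u ⬝ᵥ u = 1 := by
  have hne : ({v : Fin (n + 1) → ℝ | v ⬝ᵥ v = 1}).Nonempty := ⟨Pi.single 0 1, by simp⟩
  have hc : Continuous fun v : Fin (n + 1) → ℝ => v ⬝ᵥ (M *ᵥ v) :=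
    continuous_id.dotProduct (continuous_const.matrix_mulVec continuous_id)
  obtain ⟨u, hu1, hmin⟩ := (isCompact_dotSelf_eq_one (n + 1)).exists_isMinOn hne hc.continuousOn
  simp only [mem_setOf_eq] at hu1
  rw [isMinOn_iff] at hmin
  have hu0 : u ≠ 0 := fun h => by simp [h] at hu1
  have hval : u ⬝ᵥ (M *ᵥ u) = bottomRayleigh M := by
    refine le_antisymm (le_bottomRayleigh_of_forall M fun v hv => ?_) ?_
    · have hs : 0 < v ⬝ᵥ v := dotSelf_pos_of_ne_zero hv
      have hc2 : (Real.sqrt (v ⬝ᵥ v))⁻¹ * (Real.sqrt (v ⬝ᵥ v))⁻¹ = (v ⬝ᵥ v)⁻¹ := by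
        rw [← mul_inv, Real.mul_self_sqrt hs.le]
      have hv1 : ((Real.sqrt (v ⬝ᵥ v))⁻¹ • v) ⬝ᵥ ((Real.sqrt (v ⬝ᵥ v))⁻¹ • v) = 1 := by
        rw [smul_dotProduct, dotProduct_smul, smul_eq_mul, smul_eq_mul, ← mul_assoc, hc2,
          inv_mul_cancel₀ hs.ne']
      have h := hmin ((Real.sqrt (v ⬝ᵥ v))⁻¹ • v) hv1
      simp only [mulVec_smul, dotProduct_smul, smul_dotProduct, smul_eq_mul] at h
      rw [← mul_assoc, hc2] at h
      rwa [div_eq_inv_mul]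
    · have h := bottomRayleigh_le_rayleigh M hu0
      rwa [hu1, div_one] at h
  exact ⟨u, isBottomVector_of_form_eq hM hu0 (by rw [hval, hu1, mul_one]), hu1⟩

/-! ## §3 The variational gap binder, the direction tolerance, and the orthogonal decomposition -/

/-- **THE VARIATIONAL BOTTOM-GAP BINDER.** `HasBottomGap M u₀ γ`: `u₀` is a bottom vector of `M`, `γ > 0`, and on
the orthogonal complement of `u₀` the form is at least `(ε₁ + γ)|v|²`. For a symmetric matrix this says: the
bottom eigenvalue is simple with eigenvector `u₀` and the next eigenvalue is `≥ ε₁ + γ` (a per-window NUMERICAL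
fact about one matrix, certifiable by interval arithmetic; TYPED here as the binder of the eigenvector walls).
[folklore] -/
def HasBottomGap {n : ℕ} (M : Matrix (Fin n) (Fin n) ℝ) (u₀ : Fin n → ℝ) (γ : ℝ) : Prop :=
  IsBottomVector M u₀ ∧ 0 < γ ∧
    ∀ v : Fin n → ℝ, v ⬝ᵥ u₀ = 0 → (bottomRayleigh M + γ) * (v ⬝ᵥ v) ≤ v ⬝ᵥ (M *ᵥ v)

/-- **DIRECTION TOLERANCE** `SinSqLe τ u u₀`: `(1 − τ)|u|²|u₀|² ≤ (u·u₀)²`, i.e. `sin² ∠(u, ±u₀) ≤ τ` — the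
sign-blind (`u ↦ −u`) and scale-free (`u ↦ c u`) closeness of directions appropriate for eigenvectors. [folklore] -/
def SinSqLe {n : ℕ} (τ : ℝ) (u u₀ : Fin n → ℝ) : Prop :=
  (1 - τ) * ((u ⬝ᵥ u) * (u₀ ⬝ᵥ u₀)) ≤ (u ⬝ᵥ u₀) ^ 2

/-- PROVED: the tolerance is monotone in `τ`. [folklore] -/
theorem SinSqLe.mono {n : ℕ} {τ τ' : ℝ} {u u₀ : Fin n → ℝ} (h : SinSqLe τ u u₀) (hτ : τ ≤ τ') :
    SinSqLe τ' u u₀ := by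
  unfold SinSqLe at *
  nlinarith [mul_nonneg (dotProduct_self_nonneg_real u) (dotProduct_self_nonneg_real u₀)]

/-- PROVED: every vector is `0`-close to itself. [folklore] -/
theorem sinSqLe_zero_self {n : ℕ} (u : Fin n → ℝ) : SinSqLe 0 u u := by
  unfold SinSqLe
  rw [sub_zero, one_mul, sq]

/-- PROVED: the tolerance is SCALE-FREE in `u`. [folklore] -/
theorem SinSqLe.smul_left {n : ℕ} {τ : ℝ} {u u₀ : Fin n → ℝ} (h : SinSqLe τ u u₀) (c : ℝ) :
    SinSqLe τ (c • u) u₀ := by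
  unfold SinSqLe at *
  simp only [smul_dotProduct, dotProduct_smul, smul_eq_mul]
  have e1 : (1 - τ) * (c * (c * (u ⬝ᵥ u)) * (u₀ ⬝ᵥ u₀)) = c * c * ((1 - τ) * ((u ⬝ᵥ u) * (u₀ ⬝ᵥ u₀))) := by
    ring
  have e2 : (c * (u ⬝ᵥ u₀)) ^ 2 = c * c * (u ⬝ᵥ u₀) ^ 2 := by ring
  rw [e1, e2]
  exact mul_le_mul_of_nonneg_left h (mul_self_nonneg c)

/-- PROVED: the tolerance is SIGN-BLIND in `u`. [folklore] -/
theorem SinSqLe.neg_left {n : ℕ} {τ : ℝ} {u u₀ : Fin n → ℝ} (h : SinSqLe τ u u₀) : SinSqLe τ (-u) u₀ := by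
  have h' := h.smul_left (-1)
  rwa [neg_one_smul] at h'

/-- the (scaled) `u₀`-ORTHOGONAL PART of `u`: `orthPart u u₀ := |u₀|² u − (u·u₀) u₀` (scaled by `|u₀|²` to stay
division-free). [folklore] -/
def orthPart {n : ℕ} (u u₀ : Fin n → ℝ) : Fin n → ℝ := (u₀ ⬝ᵥ u₀) • u - (u ⬝ᵥ u₀) • u₀

/-- PROVED: `orthPart u u₀ ⊥ u₀`. [folklore] -/
theorem orthPart_dotProduct_right {n : ℕ} (u u₀ : Fin n → ℝ) : orthPart u u₀ ⬝ᵥ u₀ = 0 := by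
  simp only [orthPart, sub_dotProduct, smul_dotProduct, smul_eq_mul]
  ring

/-- PROVED: the orthogonal decomposition `|u₀|² u = orthPart u u₀ + (u·u₀) u₀`. [folklore] -/
theorem smul_eq_orthPart_add {n : ℕ} (u u₀ : Fin n → ℝ) :
    (u₀ ⬝ᵥ u₀) • u = orthPart u u₀ + (u ⬝ᵥ u₀) • u₀ := by
  rw [orthPart, sub_add_cancel]

/-- PROVED (Pythagoras): `|orthPart u u₀|² = |u₀|² (|u|²|u₀|² − (u·u₀)²)`. [folklore] -/
theorem orthPart_dotSelf {n : ℕ} (u u₀ : Fin n → ℝ) :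
    orthPart u u₀ ⬝ᵥ orthPart u u₀ = (u₀ ⬝ᵥ u₀) * ((u ⬝ᵥ u) * (u₀ ⬝ᵥ u₀) - (u ⬝ᵥ u₀) ^ 2) := by
  simp only [orthPart, sub_dotProduct, dotProduct_sub, smul_dotProduct, dotProduct_smul, smul_eq_mul]
  rw [dotProduct_comm u₀ u]
  ring

/-- PROVED: inside the `τ`-cone the orthogonal part is small, `|orthPart u u₀|² ≤ τ |u₀|⁴ |u|²`. [folklore] -/
theorem orthPart_dotSelf_le_of_sinSqLe {n : ℕ} {τ : ℝ} {u u₀ : Fin n → ℝ} (h : SinSqLe τ u u₀) :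
    orthPart u u₀ ⬝ᵥ orthPart u u₀ ≤ τ * ((u₀ ⬝ᵥ u₀) ^ 2 * (u ⬝ᵥ u)) := by
  rw [orthPart_dotSelf]
  unfold SinSqLe at h
  have hs := dotProduct_self_nonneg_real u₀
  nlinarith [mul_nonneg hs (sub_nonneg.2 h)]

/-- PROVED: under a bottom gap, EVERY bottom vector of the same (symmetric) matrix lies in the `0`-cone of `u₀`
(is parallel to `u₀`): the bottom is simple. [folklore] -/
theorem sinSqLe_zero_of_hasBottomGap {n : ℕ} {M : Matrix (Fin n) (Fin n) ℝ} (hM : M.IsSymm)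
    {u₀ : Fin n → ℝ} {γ : ℝ} (hgap : HasBottomGap M u₀ γ) {u : Fin n → ℝ} (hu : IsBottomVector M u) :
    SinSqLe 0 u u₀ := by
  obtain ⟨hu₀, hγ, hgap'⟩ := hgap
  set w := orthPart u u₀ with hw
  have hw0 : w ⬝ᵥ u₀ = 0 := orthPart_dotProduct_right u u₀
  have hdec : (u₀ ⬝ᵥ u₀) • u = w + (u ⬝ᵥ u₀) • u₀ := smul_eq_orthPart_add u u₀
  have hcross : u₀ ⬝ᵥ (M *ᵥ w) = 0 := by
    have hc : u₀ ⬝ᵥ (M *ᵥ w) = w ⬝ᵥ (M *ᵥ u₀) := by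
      rw [dotProduct_mulVec, ← mulVec_transpose, hM.eq, dotProduct_comm]
    rw [hc, dotProduct_mulVec_of_isBottomVector hu₀ w, hw0, mul_zero]
  have hdiag : u₀ ⬝ᵥ (M *ᵥ u₀) = bottomRayleigh M * (u₀ ⬝ᵥ u₀) := form_eq_of_isBottomVector hu₀
  have h3 : (u₀ ⬝ᵥ u₀) * (u₀ ⬝ᵥ u₀) * (u ⬝ᵥ (M *ᵥ u)) =
      w ⬝ᵥ (M *ᵥ w) + (u ⬝ᵥ u₀) * (u ⬝ᵥ u₀) * (bottomRayleigh M * (u₀ ⬝ᵥ u₀)) := by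
    have e : (u₀ ⬝ᵥ u₀) * (u₀ ⬝ᵥ u₀) * (u ⬝ᵥ (M *ᵥ u)) =
        ((u₀ ⬝ᵥ u₀) • u) ⬝ᵥ (M *ᵥ ((u₀ ⬝ᵥ u₀) • u)) := by
      rw [mulVec_smul, smul_dotProduct, dotProduct_smul, smul_eq_mul, smul_eq_mul, mul_assoc]
    rw [e, hdec, form_add_smul_of_isSymm hM w u₀, hcross, hdiag]
    ring
  have h4 : (bottomRayleigh M + γ) * (w ⬝ᵥ w) ≤ w ⬝ᵥ (M *ᵥ w) := hgap' w hw0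
  have h5 : w ⬝ᵥ w = (u₀ ⬝ᵥ u₀) * ((u ⬝ᵥ u) * (u₀ ⬝ᵥ u₀) - (u ⬝ᵥ u₀) ^ 2) := orthPart_dotSelf u u₀
  have hF : u ⬝ᵥ (M *ᵥ u) = bottomRayleigh M * (u ⬝ᵥ u) := form_eq_of_isBottomVector hu
  rw [h5] at h4
  rw [hF] at h3
  -- γ |u₀|² (|u|²|u₀|² − (u·u₀)²) ≤ 0
  have hs : 0 < u₀ ⬝ᵥ u₀ := dotSelf_pos_of_ne_zero hu₀.1
  have key : γ * ((u₀ ⬝ᵥ u₀) * ((u ⬝ᵥ u) * (u₀ ⬝ᵥ u₀) - (u ⬝ᵥ u₀) ^ 2)) ≤ 0 := by nlinarith [h3, h4]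
  have hX : (u ⬝ᵥ u) * (u₀ ⬝ᵥ u₀) - (u ⬝ᵥ u₀) ^ 2 ≤ 0 := by
    by_contra hlt
    push Not at hlt
    have := mul_pos hγ (mul_pos hs hlt)
    linarith
  unfold SinSqLe
  linarith

/-! ## §4 The variational DAVIS–KAHAN lemma -/

/-- **PROVED — VARIATIONAL DAVIS–KAHAN (sin² form).** Let `M₀` be symmetric with `HasBottomGap M₀ u₀ γ` and let
`M` be form-close to it, `|vᵀ(M₀ − M)v| ≤ ε |v|²` for all `v`. Then EVERY bottom vector `u` of `M` satisfies
`SinSqLe (2ε/γ) u u₀` (`sin² ∠(u, ±u₀) ≤ 2ε/γ`). Proof: `ε₁(M) ≤ ε₁(M₀) + ε` (test `u₀`), so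
`uᵀM₀u ≤ (ε₁(M₀) + 2ε)|u|²`; and with `|u₀|²u = w + (u·u₀)u₀`, `w ⊥ u₀`, the gap gives
`|u₀|⁴ uᵀM₀u ≥ ε₁(M₀)|u₀|⁴|u|² + γ|w|²`; compare. No symmetry or diagonalisation of `M` is used. [folklore] -/
theorem sinSqLe_of_isBottomVector {n : ℕ} {M₀ M : Matrix (Fin n) (Fin n) ℝ} (hM₀ : M₀.IsSymm)
    {u₀ : Fin n → ℝ} {γ ε : ℝ} (hgap : HasBottomGap M₀ u₀ γ)
    (hclose : ∀ v : Fin n → ℝ, |v ⬝ᵥ ((M₀ - M) *ᵥ v)| ≤ ε * (v ⬝ᵥ v))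
    {u : Fin n → ℝ} (hu : IsBottomVector M u) : SinSqLe (2 * ε / γ) u u₀ := by
  obtain ⟨hu₀, hγ, hgap'⟩ := hgap
  have hs : 0 < u₀ ⬝ᵥ u₀ := dotSelf_pos_of_ne_zero hu₀.1
  -- (1) ε₁(M) ≤ ε₁(M₀) + ε, testing `u₀`
  have h1 : bottomRayleigh M ≤ bottomRayleigh M₀ + ε := by
    have ha := bottomRayleigh_mul_le_form M u₀
    have hb := hclose u₀
    rw [sub_mulVec, dotProduct_sub, form_eq_of_isBottomVector hu₀] at hb
    have hb' := (abs_le.1 hb).1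
    refine le_of_mul_le_mul_right ?_ hs
    linarith
  -- (2) the form of `M₀` at `u` from above
  have h2 : u ⬝ᵥ (M₀ *ᵥ u) ≤ (bottomRayleigh M₀ + 2 * ε) * (u ⬝ᵥ u) := by
    have hb := (abs_le.1 (hclose u)).2
    rw [sub_mulVec, dotProduct_sub, form_eq_of_isBottomVector hu] at hb
    have hq := dotProduct_self_nonneg_real u
    have := mul_le_mul_of_nonneg_right h1 hq
    linarith
  -- (3) the form of `M₀` at `u` from below, via the orthogonal decomposition
  set w := orthPart u u₀ with hw
  have hw0 : w ⬝ᵥ u₀ = 0 := orthPart_dotProduct_right u u₀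
  have hdec : (u₀ ⬝ᵥ u₀) • u = w + (u ⬝ᵥ u₀) • u₀ := smul_eq_orthPart_add u u₀
  have hcross : u₀ ⬝ᵥ (M₀ *ᵥ w) = 0 := by
    have hc : u₀ ⬝ᵥ (M₀ *ᵥ w) = w ⬝ᵥ (M₀ *ᵥ u₀) := by
      rw [dotProduct_mulVec, ← mulVec_transpose, hM₀.eq, dotProduct_comm]
    rw [hc, dotProduct_mulVec_of_isBottomVector hu₀ w, hw0, mul_zero]
  have hdiag : u₀ ⬝ᵥ (M₀ *ᵥ u₀) = bottomRayleigh M₀ * (u₀ ⬝ᵥ u₀) := form_eq_of_isBottomVector hu₀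
  have h3 : (u₀ ⬝ᵥ u₀) * (u₀ ⬝ᵥ u₀) * (u ⬝ᵥ (M₀ *ᵥ u)) =
      w ⬝ᵥ (M₀ *ᵥ w) + (u ⬝ᵥ u₀) * (u ⬝ᵥ u₀) * (bottomRayleigh M₀ * (u₀ ⬝ᵥ u₀)) := by
    have e : (u₀ ⬝ᵥ u₀) * (u₀ ⬝ᵥ u₀) * (u ⬝ᵥ (M₀ *ᵥ u)) =
        ((u₀ ⬝ᵥ u₀) • u) ⬝ᵥ (M₀ *ᵥ ((u₀ ⬝ᵥ u₀) • u)) := by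
      rw [mulVec_smul, smul_dotProduct, dotProduct_smul, smul_eq_mul, smul_eq_mul, mul_assoc]
    rw [e, hdec, form_add_smul_of_isSymm hM₀ w u₀, hcross, hdiag]
    ring
  have h4 : (bottomRayleigh M₀ + γ) * (w ⬝ᵥ w) ≤ w ⬝ᵥ (M₀ *ᵥ w) := hgap' w hw0
  have h5 : w ⬝ᵥ w = (u₀ ⬝ᵥ u₀) * ((u ⬝ᵥ u) * (u₀ ⬝ᵥ u₀) - (u ⬝ᵥ u₀) ^ 2) := orthPart_dotSelf u u₀
  rw [h5] at h4
  -- (4) compare: γ |u₀|² X ≤ 2ε |u₀|⁴ |u|², X := |u|²|u₀|² − (u·u₀)²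
  have h2' := mul_le_mul_of_nonneg_left h2 (mul_nonneg hs.le hs.le)
  have key : γ * ((u₀ ⬝ᵥ u₀) * ((u ⬝ᵥ u) * (u₀ ⬝ᵥ u₀) - (u ⬝ᵥ u₀) ^ 2)) ≤
      2 * ε * ((u₀ ⬝ᵥ u₀) * (u₀ ⬝ᵥ u₀) * (u ⬝ᵥ u)) := by
    nlinarith [h3, h4, h2']
  have h6 : γ * ((u ⬝ᵥ u) * (u₀ ⬝ᵥ u₀) - (u ⬝ᵥ u₀) ^ 2) ≤ 2 * ε * ((u ⬝ᵥ u) * (u₀ ⬝ᵥ u₀)) := by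
    by_contra hlt
    push Not at hlt
    have := mul_lt_mul_of_pos_right hlt hs
    nlinarith
  have h7 : (u ⬝ᵥ u) * (u₀ ⬝ᵥ u₀) - (u ⬝ᵥ u₀) ^ 2 ≤ 2 * ε / γ * ((u ⬝ᵥ u) * (u₀ ⬝ᵥ u₀)) := by
    rw [div_mul_eq_mul_div, le_div_iff₀ hγ]
    linarith
  unfold SinSqLe
  linarith

end Summit.RiemannHypothesis.RiemannHypothesis.Theorems.PfPersistence

end
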